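import Summits.BirchSwinnertonDyer.BirchSwinnertonDyer.Theses.EisensteinPrimes
import Summits.BirchSwinnertonDyer.BirchSwinnertonDyer.Theorems.Rank1ResidualX1Isogeny
import Summits.BirchSwinnertonDyer.Rank1Residual.WAll.AltClosersX1DeepWitness
import Summits.BirchSwinnertonDyer.Rank1Residual.X2.ClassClosureEntireFree
import Literature.NumberTheory.EllipticCurves.Rank1Residual.ClassX1Isogeny
import Literature.NumberTheory.EllipticCurves.IsogenyCompProofs
import HarnessLib

/-!
# Crux `MazurMCOnX1RankZero` (route `EisensteinPrimes`, item stmt-BirchSwinnertonDyer-19035), line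
# `deepwitness` (skeleton of record 3018ca05…): the `BSD(E,p)`-DEFECT is a CLASS INVARIANT, forced `Ш`
# at every member whose analytic order is not `p`-minimal, and the MINIMAL-MEMBER normal form of the stub

HONEST FRAMING (cell `bsd-eis`, home `run/shared/lean/pub/bsd-eis/`, seat `bsd-line-x1-p2` g0, D-0154
width prover on crux 5; ladder row A3 = class X1 ∩ {r_an = 0}). THEOREMS ONLY; nothing here closes the
item, nothing is booked, no fact is restated, every deep input is a NAMED hypothesis; BSD / Mazur's main
conjecture is proved for NO curve by this file. The crux is OPEN in the refereed record on this leaf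
(Greenberg–Vatsal 2000 Thm. (1.3): GV-parity type only; Castella–Grossi–Skinner 2025 Thm. D: excludes
the anomalous case `φ|_{G_p} ∈ {1, ω}`) and CLAIMED only by the preprint Keller–Yin arXiv:2402.12781v2.

WHAT THIS FILE RECORDS. The registered load-bearing stub of the line asks, at every rank-`0` X1 pair
`(W, p)`, for SOME globally minimal member `W'` of the `ℚ`-isogeny class with a depth-`k` certificate
`ord_p #Ш_an(W') ≤ 2k ∧ p^(2k-1) ∣ #Ш(W')`. Which member, and which `k`? Cassels' isogeny invariance of
the BSD quotient (the named fact `WeierstrassCurve.bsdRHS_eq_of_isIsogenous`, `hCas`) with Faltings'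
`L(W,s) = L(W',s)` gives, for `Ш(W')` finite and `L^{(r)}(W',1)/r! ≠ 0`, the RATIO FORMULA
`#Ш_an(W) · #Ш(W') = #Ш_an(W') · #Ш(W)` (§1; the identity inside the tree's proof of
`Wuthrich2014.bsdp_of_isIsogenous`, exported here). Consequences, all kernel-checked:

* §1 `padicValRat_shaAn_sub_eq_of_isIsogenous` — the `p`-adic BSD DEFECT
  `δ_p := ord_p #Ш_an − ord_p #Ш` takes the SAME value on `ℚ`-isogenous globally minimal curves
  (class-free; inputs `hCas`, `Ш(W')` finite, leading coefficient of `W'` nonzero).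
* §1 `pow_dvd_shaOrder_of_padicValRat_shaAn_le` — FORCED Ш: `ord_p #Ш_an(W') + m ≤ ord_p #Ш_an(W)` for
  a member `W'` ⟹ `p^m ∣ #Ш(W)` (no descent; `m = 1`: every member with non-minimal `ord_p #Ш_an` has
  `p ∣ #Ш`). §2: the analytic-rank-`0` forms (finiteness / non-vanishing from `hGZK`, `hPar`).
* §3 (the line) `deepWitnessAt_iff_of_members`, `deepWitness_iff_deepWitnessAtSelf`: at a rank-`0`
  X1 pair the deep-witness predicate is a CLASS property; the registered stub (∃ member …) ⟺ the same
  certificate ON THE CURVE ITSELF (mod 5 PUB); cheapest member = `#Ш_an`-minimal, depth `⌈s_min/2⌉`,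
  none shallower anywhere (§1) — the normal form behind the row-A3 table (113 classes `k = 1`, 10
  `k = 2`, 26 twisted `k = 1`, `N < 5·10⁵`; line card `Cruxes/MazurMCOnX1RankZero/Lines/deepwitness.md`).
  `mazurMCOnX1RankZero_iff_deepWitnessAtSelf`: crux BY NAME ⟺ self certificate on SIX refereed inputs
  (`hCT hSha hGZK hPar hW16 hGr`; Cassels drops out in self currency). Named inputs of the line: 8
  (registered) → 7 (companion `…DeepWitnessSeven`) → 6 (this file); open non-PUB stubs 1.
* §4 `even_padicValRat_shaAn_sub_of_isIsogenous` / `…_of_rankZero` — with the Cassels–Tate pairing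
  (`hCT`) the PARITY of `ord_p #Ш_an` is a class invariant (an odd valuation would be shared by all).

References: [cite: MilneADT2006, Thm. I.7.3 and Remark I.7.4] [cite: Cassels1965ArithmeticVIII]
[cite: Miller2011LMS, §1 and Def. 1.1 (arXiv:1010.2431 p. 3)] [cite: Knapp1993, Thm. 11.67 (PDF p. 281)]
[cite: Wuthrich2014, Prop. 21 (p. 400)] [cite: SilvermanAEC2009, Thm. X.4.14] -/

noncomputable section

open scoped Classical

open WeierstrassCurve Literature.NumberTheory.EllipticCurves
  Literature.NumberTheory.EllipticCurves.ModularForms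
  Literature.NumberTheory.EllipticCurves.Rank1Residual
  Literature.NumberTheory.EllipticCurves.Wuthrich2014
  Summit.BirchSwinnertonDyer.Rank1Residual
  Summit.BirchSwinnertonDyer.Rank1Residual.WAll

set_option linter.dupNamespace false
set_option autoImplicit false

namespace Summit.BirchSwinnertonDyer.BirchSwinnertonDyer.Theorems.EisensteinPrimesMazurMCOnX1RankZeroDeepWitnessMinimalMember

/-! ## §1. Class-free: the ratio formula, the defect invariance, forced `Ш` -/

section ClassFree

variable {W W' : WeierstrassCurve ℚ} [W.IsElliptic] [W'.IsElliptic] [W.IsGloballyMinimal]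
  [W'.IsGloballyMinimal]

/-- **Cassels' ratio formula `#Ш_an(W) · #Ш(W') = #Ш_an(W') · #Ш(W)`** for `ℚ`-isogenous globally
minimal `W ∼ W'` with `Ш(W')` finite and `L^{(r)}(W',1)/r! ≠ 0`: the BSD quotient
`#Ш · Reg · Ω · ∏ c_ℓ / #E(ℚ)_tors²` is an isogeny invariant (`hCas`, Cassels 1965 / Milne ADT I.7.3),
`L(W,s) = L(W',s)` (Faltings; `leadingLCoeff_eq_of_isIsogenous'`), and `#Ш_an · RHS = L* · #Ш`
(`shaAn_mul_bsdRHS`). This is the identity inside the tree's proof of `Wuthrich2014.bsdp_of_isIsogenous`,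
exported. [cite: MilneADT2006, Thm. I.7.3 and Remark I.7.4] [cite: Miller2011LMS, §1 (arXiv:1010.2431 p. 3)] -/
theorem shaAn_mul_shaOrder_eq_of_isIsogenous (hCas : bsdRHS_eq_of_isIsogenous)
    (hiso : IsIsogenous W W') (hfin' : Finite W'.sha) (hlead : W'.leadingLCoeff ≠ 0) :
    shaAn W * (W'.shaOrder : ℂ) = shaAn W' * (W.shaOrder : ℂ) := by
  obtain ⟨hfin, hRHS⟩ := hCas W' W (hiso.symm_of_charZero) hfin'
  haveI : Finite W.sha := hfin
  haveI : Finite W'.sha := hfin'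
  have hlead_eq : W.leadingLCoeff = W'.leadingLCoeff := leadingLCoeff_eq_of_isIsogenous' hiso
  have hsha' : (W'.shaOrder : ℂ) ≠ 0 := by exact_mod_cast (W'.shaOrder_pos hfin').ne'
  have hRHS0 : (W'.bsdRHS : ℂ) ≠ 0 := by
    intro h0
    have h1 := shaAn_mul_bsdRHS W'
    rw [h0, mul_zero] at h1
    exact mul_ne_zero hlead hsha' h1.symm
  have h1 := shaAn_mul_bsdRHS W
  have h2 := shaAn_mul_bsdRHS W'
  rw [hRHS, hlead_eq] at h1
  have h3 : shaAn W * (W'.shaOrder : ℂ) * (W'.bsdRHS : ℂ) =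
      shaAn W' * (W.shaOrder : ℂ) * (W'.bsdRHS : ℂ) := by
    calc shaAn W * (W'.shaOrder : ℂ) * (W'.bsdRHS : ℂ)
        = (shaAn W * (W'.bsdRHS : ℂ)) * (W'.shaOrder : ℂ) := by ring
      _ = W'.leadingLCoeff * (W.shaOrder : ℂ) * (W'.shaOrder : ℂ) := by rw [h1]
      _ = (shaAn W' * (W'.bsdRHS : ℂ)) * (W.shaOrder : ℂ) := by rw [h2]; ring
      _ = shaAn W' * (W.shaOrder : ℂ) * (W'.bsdRHS : ℂ) := by ring
  exact mul_right_cancel₀ hRHS0 h3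

/-- **The rational form of the ratio formula**: with `#Ш_an(W) = q`, `#Ш_an(W') = q'` rational,
`q · #Ш(W') = q' · #Ш(W)` in `ℚ`, and `q' ≠ 0`, `#Ш(W) ≠ 0`, `#Ш(W') ≠ 0`.
[cite: MilneADT2006, Thm. I.7.3 and Remark I.7.4] [cite: Miller2011LMS, §1 (arXiv:1010.2431 p. 3)] -/
theorem ratio_rat_of_isIsogenous (hCas : bsdRHS_eq_of_isIsogenous)
    (hiso : IsIsogenous W W') (hfin' : Finite W'.sha) (hlead : W'.leadingLCoeff ≠ 0)
    {q q' : ℚ} (hq : shaAn W = (q : ℂ)) (hq' : shaAn W' = (q' : ℂ)) :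
    q * (W'.shaOrder : ℚ) = q' * (W.shaOrder : ℚ) ∧ q' ≠ 0 ∧ W.shaOrder ≠ 0 ∧ W'.shaOrder ≠ 0 := by
  obtain ⟨hfin, -⟩ := hCas W' W (hiso.symm_of_charZero) hfin'
  have hsha : W.shaOrder ≠ 0 := (W.shaOrder_pos hfin).ne'
  have hsha' : W'.shaOrder ≠ 0 := (W'.shaOrder_pos hfin').ne'
  have hq0 : q' ≠ 0 := by
    rintro rfl
    have h2 := shaAn_mul_bsdRHS W'
    rw [hq', Rat.cast_zero, zero_mul] at h2
    have : (W'.shaOrder : ℂ) ≠ 0 := by exact_mod_cast hsha'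
    exact mul_ne_zero hlead this h2.symm
  have h := shaAn_mul_shaOrder_eq_of_isIsogenous hCas hiso hfin' hlead
  rw [hq, hq'] at h
  refine ⟨?_, hq0, hsha, hsha'⟩
  exact_mod_cast h

/-- **The `p`-adic BSD DEFECT `δ_p = ord_p #Ш_an − ord_p #Ш` is an isogeny invariant** (class-free
form): for `ℚ`-isogenous globally minimal `W ∼ W'` with `Ш(W')` finite, `L^{(r)}(W',1)/r! ≠ 0`,
`#Ш_an(W) = q`, `#Ш_an(W') = q'`, one has `ord_p q − ord_p #Ш(W) = ord_p q' − ord_p #Ш(W')` at every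
prime `p`. (Valuations of the ratio formula; `BSD(W,p) ⟺ δ_p(W) = 0`, so this refines the tree's
`Wuthrich2014.bsdp_of_isIsogenous`.) [cite: MilneADT2006, Thm. I.7.3 and Remark I.7.4]
[cite: Miller2011LMS, §1 and Def. 1.1 (arXiv:1010.2431 p. 3)] -/
theorem padicValRat_shaAn_sub_eq_of_isIsogenous (hCas : bsdRHS_eq_of_isIsogenous)
    (hiso : IsIsogenous W W') (hfin' : Finite W'.sha) (hlead : W'.leadingLCoeff ≠ 0)
    (p : ℕ) [Fact p.Prime] {q q' : ℚ} (hq : shaAn W = (q : ℂ)) (hq' : shaAn W' = (q' : ℂ)) :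
    padicValRat p q - padicValNat p W.shaOrder = padicValRat p q' - padicValNat p W'.shaOrder := by
  obtain ⟨h, hq0, hsha, hsha'⟩ := ratio_rat_of_isIsogenous hCas hiso hfin' hlead hq hq'
  have hshaQ : (W.shaOrder : ℚ) ≠ 0 := by exact_mod_cast hsha
  have hshaQ' : (W'.shaOrder : ℚ) ≠ 0 := by exact_mod_cast hsha'
  have hq00 : q ≠ 0 := by
    intro h0
    rw [h0, zero_mul] at h
    exact mul_ne_zero hq0 hshaQ h.symm
  have hv := congrArg (padicValRat p) h
  rw [padicValRat.mul hq00 hshaQ', padicValRat.mul hq0 hshaQ, padicValRat.of_nat,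
    padicValRat.of_nat] at hv
  linarith

/-- **FORCED Ш from the class's analytic orders**: if a member `W'` of the `ℚ`-isogeny class of `W`
(`Ш(W')` finite, `L^{(r)}(W',1)/r! ≠ 0`) has `ord_p #Ш_an(W') + m ≤ ord_p #Ш_an(W)`, then
`p^m ∣ #Ш(W)`. No descent: the elements are forced by Cassels' invariance (`δ_p` constant on the
class and `ord_p #Ш(W') ≥ 0`). [cite: MilneADT2006, Thm. I.7.3 and Remark I.7.4]
[cite: Miller2011LMS, §1 and Def. 1.1 (arXiv:1010.2431 p. 3)] -/
theorem pow_dvd_shaOrder_of_padicValRat_shaAn_le (hCas : bsdRHS_eq_of_isIsogenous)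
    (hiso : IsIsogenous W W') (hfin' : Finite W'.sha) (hlead : W'.leadingLCoeff ≠ 0)
    (p : ℕ) [Fact p.Prime] {q q' : ℚ} (hq : shaAn W = (q : ℂ)) (hq' : shaAn W' = (q' : ℂ))
    {m : ℕ} (hle : padicValRat p q' + m ≤ padicValRat p q) : p ^ m ∣ W.shaOrder := by
  obtain ⟨-, -, hsha, -⟩ := ratio_rat_of_isIsogenous hCas hiso hfin' hlead hq hq'
  have hδ := padicValRat_shaAn_sub_eq_of_isIsogenous hCas hiso hfin' hlead p hq hq'
  have h0 : (0 : ℤ) ≤ padicValNat p W'.shaOrder := by exact_mod_cast Nat.zero_le _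
  have hm : (m : ℤ) ≤ padicValNat p W.shaOrder := by linarith
  exact (padicValNat_dvd_iff_le hsha).mpr (by exact_mod_cast hm)

/-- **In particular (`m = 1`)**: a member of the class whose analytic order of `Ш` is NOT `p`-minimal
(`ord_p #Ш_an(W') < ord_p #Ш_an(W)` for some member `W'`) has `p ∣ #Ш(W)`.
[cite: MilneADT2006, Thm. I.7.3 and Remark I.7.4] [cite: Miller2011LMS, §1 and Def. 1.1 (arXiv:1010.2431 p. 3)] -/
theorem dvd_shaOrder_of_padicValRat_shaAn_lt (hCas : bsdRHS_eq_of_isIsogenous)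
    (hiso : IsIsogenous W W') (hfin' : Finite W'.sha) (hlead : W'.leadingLCoeff ≠ 0)
    (p : ℕ) [Fact p.Prime] {q q' : ℚ} (hq : shaAn W = (q : ℂ)) (hq' : shaAn W' = (q' : ℂ))
    (hlt : padicValRat p q' < padicValRat p q) : p ∣ W.shaOrder := by
  simpa using pow_dvd_shaOrder_of_padicValRat_shaAn_le hCas hiso hfin' hlead p hq hq' (m := 1)
    (by push_cast; linarith)

/-- **No member is cheaper than the minimum**: conversely `ord_p #Ш(W) ≤ ord_p #Ш_an(W) − ord_p #Ш_an(W')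
+ ord_p #Ш(W')`, so when `W'` realises the class minimum of `ord_p #Ш_an` and `BSD` fails nowhere
worse than at `W'`, certificates at `W` are at least as deep as at `W'`: precisely
`ord_p #Ш(W) − ord_p #Ш(W') = ord_p #Ш_an(W) − ord_p #Ш_an(W')` (restatement of §1 for the desks).
[cite: MilneADT2006, Thm. I.7.3 and Remark I.7.4] -/
theorem padicValNat_shaOrder_sub_eq_of_isIsogenous (hCas : bsdRHS_eq_of_isIsogenous)
    (hiso : IsIsogenous W W') (hfin' : Finite W'.sha) (hlead : W'.leadingLCoeff ≠ 0)
    (p : ℕ) [Fact p.Prime] {q q' : ℚ} (hq : shaAn W = (q : ℂ)) (hq' : shaAn W' = (q' : ℂ)) :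
    (padicValNat p W.shaOrder : ℤ) - padicValNat p W'.shaOrder = padicValRat p q - padicValRat p q' := by
  have := padicValRat_shaAn_sub_eq_of_isIsogenous hCas hiso hfin' hlead p hq hq'
  linarith

end ClassFree

/-! ## §2. Analytic rank `0`: finiteness and non-vanishing from GZK + modular parametrisation -/

section RankZero

/-- **Forced Ш at analytic rank `0`, inputs by name**: `W ∼ W'` globally minimal, `ord_{s=1} L(W,s) = 0`;
if `ord_p #Ш_an(W') + m ≤ ord_p #Ш_an(W)` then `p^m ∣ #Ш(W)`. Finiteness of `Ш(W')` from
Gross–Zagier–Kolyvagin (`hGZK`, rank transported by Faltings), `L(W',1) ≠ 0` from the entire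
continuation (modular parametrisation `hPar` ⇒ `hasEntireLFunction_rat`). Cassels' invariance `hCas`.
Applies verbatim on X1 (and on every other class): the member of a Mazur class carrying the
non-minimal `#Ш_an` has non-trivial `Ш[p^∞]` of the forced size.
[cite: MilneADT2006, Thm. I.7.3 and Remark I.7.4] [cite: Darmon2004, Thm. 3.22] [cite: BCDTJAMS2001, Theorem A] -/
theorem pow_dvd_shaOrder_of_rankZero_of_padicValRat_shaAn_le (hCas : bsdRHS_eq_of_isIsogenous)
    (hGZK : rank_eq_analyticRank_of_analyticRank_le_one) (hPar : nonempty_modularParametrizationData)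
    (W W' : WeierstrassCurve ℚ) [W.IsElliptic] [W'.IsElliptic] [W.IsGloballyMinimal]
    [W'.IsGloballyMinimal] (hiso : IsIsogenous W W') (hr0 : W.analyticRank = 0)
    (p : ℕ) [Fact p.Prime] {q q' : ℚ} (hq : shaAn W = (q : ℂ)) (hq' : shaAn W' = (q' : ℂ))
    {m : ℕ} (hle : padicValRat p q' + m ≤ padicValRat p q) : p ^ m ∣ W.shaOrder := by
  have hmod : hasEntireLFunction_rat :=
    X2.ClassClosureEntireFree.hasEntireLFunction_rat_of_nonempty_modularParametrizationData hPar
  have hr0' : W'.analyticRank = 0 := (analyticRank_eq_of_isIsogenous' hiso) ▸ hr0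
  obtain ⟨-, hfin'⟩ := hGZK W' (by omega)
  have hlead : W'.leadingLCoeff ≠ 0 := W'.leadingLCoeff_ne_zero_holds (hmod W')
  exact pow_dvd_shaOrder_of_padicValRat_shaAn_le hCas hiso hfin' hlead p hq hq' hle

/-- **The defect invariance at analytic rank `0`, inputs by name** (`hCas`, `hGZK`, `hPar`):
`ord_p #Ш_an(W) − ord_p #Ш(W) = ord_p #Ш_an(W') − ord_p #Ш(W')` for `W ∼ W'`, `ord_{s=1} L(W,s) = 0`.
[cite: MilneADT2006, Thm. I.7.3 and Remark I.7.4] [cite: Darmon2004, Thm. 3.22] -/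
theorem padicValRat_shaAn_sub_eq_of_rankZero (hCas : bsdRHS_eq_of_isIsogenous)
    (hGZK : rank_eq_analyticRank_of_analyticRank_le_one) (hPar : nonempty_modularParametrizationData)
    (W W' : WeierstrassCurve ℚ) [W.IsElliptic] [W'.IsElliptic] [W.IsGloballyMinimal]
    [W'.IsGloballyMinimal] (hiso : IsIsogenous W W') (hr0 : W.analyticRank = 0)
    (p : ℕ) [Fact p.Prime] {q q' : ℚ} (hq : shaAn W = (q : ℂ)) (hq' : shaAn W' = (q' : ℂ)) :
    padicValRat p q - padicValNat p W.shaOrder = padicValRat p q' - padicValNat p W'.shaOrder := by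
  have hmod : hasEntireLFunction_rat :=
    X2.ClassClosureEntireFree.hasEntireLFunction_rat_of_nonempty_modularParametrizationData hPar
  have hr0' : W'.analyticRank = 0 := (analyticRank_eq_of_isIsogenous' hiso) ▸ hr0
  obtain ⟨-, hfin'⟩ := hGZK W' (by omega)
  have hlead : W'.leadingLCoeff ≠ 0 := W'.leadingLCoeff_ne_zero_holds (hmod W')
  exact padicValRat_shaAn_sub_eq_of_isIsogenous hCas hiso hfin' hlead p hq hq'

end RankZero

/-! ## §3. The line: the deep witness is a CLASS property; minimal-member normal form -/

section Line

/-- **At a rank-`0` X1 pair, a deep witness on ONE member gives a deep witness on EVERY member** (each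
with its own depth): from `(W', q', k')` with `ord_p q' ≤ 2k'`, `p^(2k'-1) ∣ #Ш(W')` to `BSD(W',p)`
(the X1 lever `X1.bsdp_of_casselsTate_of_pow_dvd`: Kato–Wuthrich + Cassels–Tate squareness), across the
class by Cassels' invariance (`Wuthrich2014.bsdp_of_isIsogenous`), and back to a witness on `W''` by
ty-2's `exists_pow_dvd_shaOrder_of_bsdp` (`k'' = ⌈ord_p #Ш(W'')/2⌉`). Five refereed inputs
(`hCT hSha hGZK hCas hPar`). CONDITIONAL; nothing closed. [cite: Wuthrich2014, Prop. 21 (p. 400)]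
[cite: SilvermanAEC2009, Thm. X.4.14] [cite: MilneADT2006, Thm. I.7.3 and Remark I.7.4] -/
theorem deepWitnessAt_member_of_deepWitnessAt_member (hCT : exists_casselsTate_pairing (K := ℚ))
    (hSha : Wuthrich2014.sha_dvd_analyticSha) (hGZK : rank_eq_analyticRank_of_analyticRank_le_one)
    (hCas : bsdRHS_eq_of_isIsogenous) (hPar : nonempty_modularParametrizationData)
    (W W' W'' : WeierstrassCurve ℚ) [W.IsElliptic] [W'.IsElliptic] [W''.IsElliptic]
    [W.IsGloballyMinimal] [W'.IsGloballyMinimal] [W''.IsGloballyMinimal]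
    (hiso' : IsIsogenous W W') (hiso'' : IsIsogenous W W'') (p : ℕ) [Fact p.Prime]
    (hX1 : ClassX1 W p) (hr0 : W.analyticRank = 0)
    {q' : ℚ} (hq' : shaAn W' = (q' : ℂ)) {k' : ℕ} (hv' : padicValRat p q' ≤ 2 * k')
    (hdvd' : p ^ (2 * k' - 1) ∣ W'.shaOrder) :
    ∃ q'' : ℚ, shaAn W'' = (q'' : ℂ) ∧
      ∃ k'' : ℕ, padicValRat p q'' ≤ 2 * k'' ∧ p ^ (2 * k'' - 1) ∣ W''.shaOrder := by
  have hmod : hasEntireLFunction_rat :=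
    X2.ClassClosureEntireFree.hasEntireLFunction_rat_of_nonempty_modularParametrizationData hPar
  have hX1' : ClassX1 W' p := ClassX1.of_isIsogenous hiso' hX1
  have hr0' : W'.analyticRank = 0 := (analyticRank_eq_of_isIsogenous' hiso') ▸ hr0
  have hr0'' : W''.analyticRank = 0 := (analyticRank_eq_of_isIsogenous' hiso'') ▸ hr0
  have hB' : BSDp W' p :=
    X1.bsdp_of_casselsTate_of_pow_dvd hCT hSha hGZK hmod W' p (by omega) hX1' hr0' hq' hv' hdvd'
  obtain ⟨-, hfin'⟩ := hGZK W' (by omega)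
  obtain ⟨-, hfin''⟩ := hGZK W'' (by omega)
  have hlead' : W'.leadingLCoeff ≠ 0 := W'.leadingLCoeff_ne_zero_holds (hmod W')
  have hiso : IsIsogenous W'' W' := (hiso''.symm_of_charZero).trans' hiso'
  have hB'' : BSDp W'' p := bsdp_of_isIsogenous hCas hiso hfin' hlead' hB'
  have hB := hB''
  obtain ⟨-, -, q'', hq'', -⟩ := hB
  exact ⟨q'', hq'', exists_pow_dvd_shaOrder_of_bsdp W'' p hfin'' hB'' hq''⟩

/-- **Hence the deep-witness predicate is a CLASS property**: at a rank-`0` X1 pair `(W, p)` and for any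
two members `W', W''` of the class, "`W'` carries a deep witness (for some `k`)" ⟺ "`W''` carries a deep
witness (for some `k`)". Modulo `hCT hSha hGZK hCas hPar`. [cite: MilneADT2006, Thm. I.7.3 and Remark I.7.4]
[cite: Wuthrich2014, Prop. 21 (p. 400)] [cite: SilvermanAEC2009, Thm. X.4.14] -/
theorem deepWitnessAt_iff_of_members (hCT : exists_casselsTate_pairing (K := ℚ))
    (hSha : Wuthrich2014.sha_dvd_analyticSha) (hGZK : rank_eq_analyticRank_of_analyticRank_le_one)
    (hCas : bsdRHS_eq_of_isIsogenous) (hPar : nonempty_modularParametrizationData)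
    (W W' W'' : WeierstrassCurve ℚ) [W.IsElliptic] [W'.IsElliptic] [W''.IsElliptic]
    [W.IsGloballyMinimal] [W'.IsGloballyMinimal] [W''.IsGloballyMinimal]
    (hiso' : IsIsogenous W W') (hiso'' : IsIsogenous W W'') (p : ℕ) [Fact p.Prime]
    (hX1 : ClassX1 W p) (hr0 : W.analyticRank = 0) :
    (∃ q' : ℚ, shaAn W' = (q' : ℂ) ∧
      ∃ k' : ℕ, padicValRat p q' ≤ 2 * k' ∧ p ^ (2 * k' - 1) ∣ W'.shaOrder) ↔
    (∃ q'' : ℚ, shaAn W'' = (q'' : ℂ) ∧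
      ∃ k'' : ℕ, padicValRat p q'' ≤ 2 * k'' ∧ p ^ (2 * k'' - 1) ∣ W''.shaOrder) :=
  ⟨fun ⟨_, hq', _, hv', hdvd'⟩ ↦ deepWitnessAt_member_of_deepWitnessAt_member hCT hSha hGZK hCas hPar
      W W' W'' hiso' hiso'' p hX1 hr0 hq' hv' hdvd',
    fun ⟨_, hq'', _, hv'', hdvd''⟩ ↦ deepWitnessAt_member_of_deepWitnessAt_member hCT hSha hGZK hCas
      hPar W W'' W' hiso'' hiso' p hX1 hr0 hq'' hv'' hdvd''⟩

/-- **MINIMAL-MEMBER / SELF NORMAL FORM of the registered stub.** Modulo `hCT hSha hGZK hCas hPar`, the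
stub `stub_deepWitness` of the line `deepwitness` (∃ a member `W'` of the class with a deep witness) is
EQUIVALENT to the same certificate demanded ON THE CURVE ITSELF:
`∀ rank-0 X1 (W,p), ∃ q k, #Ш_an(W) = q ∧ ord_p q ≤ 2k ∧ p^(2k-1) ∣ #Ш(W)`. The quantifier over members
buys nothing class-wide; per cell it buys COST only — by §1 the forced part of `Ш` sits at the members
with non-minimal `ord_p #Ш_an`, so the cheapest certificate of a class is at an `#Ш_an`-minimal member,
of depth `⌈s_min/2⌉`, and no member admits a shallower one. [cite: MilneADT2006, Thm. I.7.3 and Remark I.7.4]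
[cite: Wuthrich2014, Prop. 21 (p. 400)] [cite: SilvermanAEC2009, Thm. X.4.14] [cite: Miller2011LMS, Def. 1.1 (arXiv:1010.2431 p. 3)] -/
theorem deepWitness_iff_deepWitnessAtSelf (hCT : exists_casselsTate_pairing (K := ℚ))
    (hSha : Wuthrich2014.sha_dvd_analyticSha) (hGZK : rank_eq_analyticRank_of_analyticRank_le_one)
    (hCas : bsdRHS_eq_of_isIsogenous) (hPar : nonempty_modularParametrizationData) :
    (∀ (W : WeierstrassCurve ℚ) [W.IsElliptic] [W.IsGloballyMinimal] (p : ℕ)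
      [Fact p.Prime], ClassX1 W p → W.analyticRank = 0 →
      ∃ (W' : WeierstrassCurve ℚ) (_ : W'.IsElliptic) (_ : W'.IsGloballyMinimal), IsIsogenous W W' ∧
        ∃ q : ℚ, shaAn W' = (q : ℂ) ∧ ∃ k : ℕ, padicValRat p q ≤ 2 * k ∧ p ^ (2 * k - 1) ∣ W'.shaOrder) ↔
    (∀ (W : WeierstrassCurve ℚ) [W.IsElliptic] [W.IsGloballyMinimal] (p : ℕ)
      [Fact p.Prime], ClassX1 W p → W.analyticRank = 0 →
        ∃ q : ℚ, shaAn W = (q : ℂ) ∧ ∃ k : ℕ, padicValRat p q ≤ 2 * k ∧ p ^ (2 * k - 1) ∣ W.shaOrder) := by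
  refine ⟨fun h W iE iM p _ hX1 hr0 ↦ ?_, fun h W iE iM p _ hX1 hr0 ↦ ?_⟩
  · obtain ⟨W', iE', iM', hiso, q', hq', k', hv', hdvd'⟩ := h W p hX1 hr0
    exact deepWitnessAt_member_of_deepWitnessAt_member hCT hSha hGZK hCas hPar W W' W hiso
      (isIsogenous_self W) p hX1 hr0 hq' hv' hdvd'
  · obtain ⟨q, hq, k, hv, hdvd⟩ := h W p hX1 hr0
    exact ⟨W, iE, iM, isIsogenous_self W, q, hq, k, hv, hdvd⟩

/-- **The crux in SELF currency** (route decl by name): `MazurMCOnX1RankZero` ⟺ every rank-`0` X1 curve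
ITSELF carries a deep Ш-witness — modulo SIX refereed inputs (`hCT hSha hGZK hPar`, Wuthrich Thm. 16
`hW16`, Greenberg Thm. 4.1 `hGr`); Cassels' invariance is NOT needed in self currency. Directly: the
converse chain `Rank1ResidualX1Converse.mazurMainConjectureOnX1_rankZero_iff`, the lever
`X1.bsdp_of_casselsTate_of_pow_dvd` (⇐) and ty-2's `exists_pow_dvd_shaOrder_of_bsdp` (⇒). So the
line's member-quantifier costs exactly one refereed input (Cassels) and buys per-cell cost only.
CONDITIONAL; the item stays open.
[cite: Wuthrich2014, Thm. 16 (p. 397) and Prop. 21 (p. 400)] [cite: GreenbergLNM1716, Thm. 4.1]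
[cite: SilvermanAEC2009, Thm. X.4.14] [cite: Miller2011LMS, Def. 1.1 (arXiv:1010.2431 p. 3)] -/
theorem mazurMCOnX1RankZero_iff_deepWitnessAtSelf (hCT : exists_casselsTate_pairing (K := ℚ))
    (hSha : Wuthrich2014.sha_dvd_analyticSha) (hGZK : rank_eq_analyticRank_of_analyticRank_le_one)
    (hPar : nonempty_modularParametrizationData)
    (hW16 : Wuthrich2014.charIdeal_dvd_padicLFunction) (hGr : greenberg_charValue_rankZero) :
    Summit.BirchSwinnertonDyer.BirchSwinnertonDyer.Theses.EisensteinPrimes.MazurMCOnX1RankZero ↔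
    (∀ (W : WeierstrassCurve ℚ) [W.IsElliptic] [W.IsGloballyMinimal] (p : ℕ)
      [Fact p.Prime], ClassX1 W p → W.analyticRank = 0 →
        ∃ q : ℚ, shaAn W = (q : ℂ) ∧ ∃ k : ℕ, padicValRat p q ≤ 2 * k ∧ p ^ (2 * k - 1) ∣ W.shaOrder) := by
  have hmod : hasEntireLFunction_rat :=
    X2.ClassClosureEntireFree.hasEntireLFunction_rat_of_nonempty_modularParametrizationData hPar
  constructor
  · intro h W iE iM p _ hX1 hr0
    have hB : BSDp W p :=
      (Rank1ResidualX1Converse.mazurMainConjectureOnX1_rankZero_iff hW16 hGr hPar hGZK).mp h W p hX1 hr0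
    obtain ⟨-, hfin⟩ := hGZK W (by omega)
    have hB' := hB
    obtain ⟨-, -, q, hq, -⟩ := hB'
    exact ⟨q, hq, exists_pow_dvd_shaOrder_of_bsdp W p hfin hB hq⟩
  · intro h
    exact (Rank1ResidualX1Converse.mazurMainConjectureOnX1_rankZero_iff hW16 hGr hPar hGZK).mpr
      fun W _ _ p _ hX1 hr0 ↦ by
        obtain ⟨q, hq, k, hv, hdvd⟩ := h W p hX1 hr0
        exact X1.bsdp_of_casselsTate_of_pow_dvd hCT hSha hGZK hmod W p (by omega) hX1 hr0 hq hv hdvd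

end Line

/-! ## §4. The PARITY of `ord_p #Ш_an` is a class invariant (Cassels–Tate squareness added) -/

section Parity

variable {W W' : WeierstrassCurve ℚ} [W.IsElliptic] [W'.IsElliptic] [W.IsGloballyMinimal]
  [W'.IsGloballyMinimal]

/-- **`ord_p #Ш_an` has the SAME PARITY on `ℚ`-isogenous curves** (class-free): for globally minimal
`W ∼ W'`, `Ш(W')` finite, `L^{(r)}(W',1)/r! ≠ 0`, `#Ш_an(W) = q`, `#Ш_an(W') = q'`, the integer
`ord_p q − ord_p q'` is EVEN: it equals `ord_p #Ш(W) − ord_p #Ш(W')` (§1, `hCas`) and both orders are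
squares (`hCT`, `isSquare_shaOrder_of_casselsTate`). The squareness of `#Ш_an` itself is not known; an
odd valuation would be shared by the whole class. [cite: MilneADT2006, Thm. I.7.3 and Remark I.7.4]
[cite: SilvermanAEC2009, Thm. X.4.14] -/
theorem even_padicValRat_shaAn_sub_of_isIsogenous (hCT : exists_casselsTate_pairing (K := ℚ))
    (hCas : bsdRHS_eq_of_isIsogenous) (hiso : IsIsogenous W W') (hfin' : Finite W'.sha)
    (hlead : W'.leadingLCoeff ≠ 0) (p : ℕ) [Fact p.Prime] {q q' : ℚ} (hq : shaAn W = (q : ℂ))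
    (hq' : shaAn W' = (q' : ℂ)) : Even (padicValRat p q - padicValRat p q') := by
  obtain ⟨hfin, -⟩ := hCas W' W (hiso.symm_of_charZero) hfin'
  -- both `#Ш` are nonzero perfect squares (Cassels–Tate), so their valuations are even
  obtain ⟨a, ha⟩ := isSquare_shaOrder_of_casselsTate hCT W hfin
  obtain ⟨b, hb⟩ := isSquare_shaOrder_of_casselsTate hCT W' hfin'
  have ha0 : a ≠ 0 := fun h0 => (W.shaOrder_pos hfin).ne' (by rw [ha, h0, mul_zero])
  have hb0 : b ≠ 0 := fun h0 => (W'.shaOrder_pos hfin').ne' (by rw [hb, h0, mul_zero])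
  have hva : padicValNat p W.shaOrder = padicValNat p a + padicValNat p a := by
    rw [ha, padicValNat.mul ha0 ha0]
  have hvb : padicValNat p W'.shaOrder = padicValNat p b + padicValNat p b := by
    rw [hb, padicValNat.mul hb0 hb0]
  have h := padicValNat_shaOrder_sub_eq_of_isIsogenous hCas hiso hfin' hlead p hq hq'
  exact ⟨(padicValNat p a : ℤ) - padicValNat p b, by rw [← h, hva, hvb]; push_cast; ring⟩

/-- **Rank-`0` form, inputs by name** (`hCT hCas hGZK hPar`): on the `ℚ`-isogeny class of a curve of
analytic rank `0`, `ord_p #Ш_an` is constant modulo `2`; so if ONE member has a unit analytic order at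
`p` (the row-A3 `k = 0` certificate), every member has EVEN `ord_p #Ш_an`.
[cite: MilneADT2006, Thm. I.7.3 and Remark I.7.4] [cite: SilvermanAEC2009, Thm. X.4.14] -/
theorem even_padicValRat_shaAn_sub_of_rankZero (hCT : exists_casselsTate_pairing (K := ℚ))
    (hCas : bsdRHS_eq_of_isIsogenous) (hGZK : rank_eq_analyticRank_of_analyticRank_le_one)
    (hPar : nonempty_modularParametrizationData)
    (W W' : WeierstrassCurve ℚ) [W.IsElliptic] [W'.IsElliptic] [W.IsGloballyMinimal]
    [W'.IsGloballyMinimal] (hiso : IsIsogenous W W') (hr0 : W.analyticRank = 0)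
    (p : ℕ) [Fact p.Prime] {q q' : ℚ} (hq : shaAn W = (q : ℂ)) (hq' : shaAn W' = (q' : ℂ)) :
    Even (padicValRat p q - padicValRat p q') := by
  have hmod : hasEntireLFunction_rat :=
    X2.ClassClosureEntireFree.hasEntireLFunction_rat_of_nonempty_modularParametrizationData hPar
  have hr0' : W'.analyticRank = 0 := (analyticRank_eq_of_isIsogenous' hiso) ▸ hr0
  exact even_padicValRat_shaAn_sub_of_isIsogenous hCT hCas hiso (hGZK W' (by omega)).2
    (W'.leadingLCoeff_ne_zero_holds (hmod W')) p hq hq'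

end Parity

end Summit.BirchSwinnertonDyer.BirchSwinnertonDyer.Theorems.EisensteinPrimesMazurMCOnX1RankZeroDeepWitnessMinimalMember

end
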